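import Summits.BirchSwinnertonDyer.Rank1Residual.ManinAdditive.ShimuraKernel
import Summits.BirchSwinnertonDyer.BirchSwinnertonDyer.Theorems.ManinLocalTwoThreeBlindNoDoubling
import Literature.NumberTheory.EllipticCurves.ShimuraSubgroupHeckeCongruence
import HarnessLib

/-!
# S-an-65 `KernelToLedgerEdge` IS A THEOREM (kernel form ⟹ ledger form on `a₁ = a₃ = 0` models), and the kernel-row assembly
# of C2 (cell `bsd-f2-manin`, planner `an` g33, MEMO-an §76 addendum; TURNKEY-an-27 file (h); nothing asserted about C2)

TYPER NOTE (typer g18).  The route-independent leaf `ShimuraKernel.lean` (p701658) was landed from an's DELIVERED sketch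
HOME/an/g33/Sketch-an-g33.lean sha16 a6fc19f06f502f50, where S-an-65 `KernelToLedgerEdge` is a NODE and `transfer_of_kernel_rows` takes it as
the hypothesis `(h65 : KernelToLedgerEdge)`.  While that file was in the gate an PROVED the node in-sketch (sha16 52f958bbf463cbb9, 410 l., farm
Sketch_check6.json rc 0 · 0 err · 0 warn · 0 sorry; node bodies unchanged — diffed).  This theorem-only, ROUTE-INDEPENDENT sibling (imports
`ShimuraKernel` + the Theses-free Theorems file `ManinLocalTwoThreeBlindNoDoubling` for the LEAD's Vélu step `false_of_blind_halfPeriod_neronLattice`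
and `halfLattice_trichotomy`) lands the delta VERBATIM: **`kernelToLedgerEdge_holds : KernelToLedgerEdge`** (S-an-65 DISCHARGED BY NAME: the
LEAD's `index_four_of_allBlind_of_natAbs_eq_two_mul` with `AllRationalTwoTorsionBlind` replaced by E-an-152 at the ONE root attached to the
produced half-period), `transfer_of_kernel_rows'` (= an's 2-argument THEOREM form «E-an-152 ∧ E-an-152b ⟹ E-an-151 on `a₁ = a₃ = 0` models»;
PRIMED because the 3-argument node form `transfer_of_kernel_rows (h65) (h152) (h152b)` already carries the name in `ShimuraKernel.lean` — the
primed one is that theorem fed `kernelToLedgerEdge_holds`), `maninOdd_of_kernel_rows` (THE KERNEL-ROW ASSEMBLY OF C2: on globally minimal models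
with `a₁ = a₃ = 0`, C2 for a lattice-optimal `X₀(N)`-datum ⟸ F-need ∧ C2¹-class ∧ E-an-152 ∧ E-an-152b) and
`maninOdd_of_kernel_rows_of_gammaOneOddAtFour` (same with es's E-es-112).  0 sorry; no new fact; nothing asserts C2, Manin's conjecture
or BSD.  PARTITION 0; beyond-print theorem: NO (bookkeeping over tree theorems between obligation nodes); bears_on: stmt-BirchSwinnertonDyer-22967.
BSD is not proved by this; C2/C3 OPEN.
[cite: LingOesterle1991, Thm. 6 (2Λ₀(f) ⊆ Λ₁(f) at a traceless prime; tree `pMulLatticeLeGamma1OfTracelessPrime_holds`)]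
[cite: CesnaviciusNeururerSaha2023, Lemma 6.5 (the ledger dichotomy c₀ = n·c₁; tree `natAbs_maninConstant₀_eq_or_eq_two_mul_of_four_dvd_level`)]
-/

set_option autoImplicit false

noncomputable section

open WeierstrassCurve Literature.NumberTheory.EllipticCurves Literature.NumberTheory.EllipticCurves.ModularForms
open CongruenceSubgroup
open Summit.BirchSwinnertonDyer.Rank1Residual.ManinAdditive.ShimuraLedger
open Summit.BirchSwinnertonDyer.Rank1Residual.ManinAdditive.CuspidalKummer
open Summit.BirchSwinnertonDyer.Rank1Residual.ManinAdditive.KatoCurve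
open Summit.BirchSwinnertonDyer.BirchSwinnertonDyer.Theorems.ManinLocalTwoThree

namespace Summit.BirchSwinnertonDyer.Rank1Residual.ManinAdditive.ShimuraKernel

/-- **S-an-65 PROVED: `KernelToLedgerEdge` holds** — the LEAD's `index_four_of_allBlind_of_natAbs_eq_two_mul`
(BlindNoDoubling) with `AllRationalTwoTorsionBlind` replaced by E-an-152 at the ONE root attached to the produced half-period
`z₀ = c₁w₁ = c₀(εw₁)/2`.  Inputs: ledger dichotomy, Ling–Oesterlé `2Λ₀ ⊆ Λ₁`, half-lattice trichotomy, the Vélu step. -/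
theorem kernelToLedgerEdge_holds : KernelToLedgerEdge := by
  intro h152 W₁ W₀ _ _ _ _ N _ D₁ D₀ hiso h₁ h₀ h4 ha₁ ha₃ hne4
  rcases natAbs_maninConstant₀_eq_or_eq_two_mul_of_four_dvd_level D₁ D₀ hiso h₁ h₀ h4 with heq | hdouble
  · exact heq
  exfalso
  have hf : D₁.f = D₀.f := D₁.f_eq_of_isIsogenous D₀ hiso
  have hc₁ : (D₁.c : ℂ) ≠ 0 := by exact_mod_cast D₁.maninConstant_ne_zero
  have hc₁0 : D₁.maninConstant.natAbs ≠ 0 := Int.natAbs_ne_zero.mpr D₁.maninConstant_ne_zero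
  -- `c₀ = ε · 2c₁`, `ε = ±1`
  obtain ⟨ε, hε, hcc⟩ : ∃ ε : ℂ, (ε = 1 ∨ ε = -1) ∧ (D₀.c : ℂ) = ε * (2 * D₁.c) := by
    have h : D₀.maninConstant.natAbs = (2 * D₁.maninConstant).natAbs := by rw [hdouble, Int.natAbs_mul]; rfl
    rcases Int.natAbs_eq_natAbs_iff.mp h with h' | h'
    · exact ⟨1, Or.inl rfl, by rw [one_mul]; exact_mod_cast h'⟩
    · exact ⟨-1, Or.inr rfl, by rw [neg_one_mul]; exact_mod_cast h'⟩
  have hε2 : ε * ε = 1 := by rcases hε with rfl | rfl <;> norm_num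
  have hεmem : ∀ (S : AddSubgroup ℂ) (w : ℂ), w ∈ S → ε * w ∈ S := by
    intro S w hw; rcases hε with rfl | rfl
    · rwa [one_mul]
    · rw [neg_one_mul]; exact neg_mem hw
  -- Ling–Oesterlé at the traceless prime `2`: `2Λ₀ ⊆ Λ₁`
  have h2Λ : ∀ w ∈ periodLattice D₀.f, (2 : ℂ) * w ∈ periodLatticeGamma1 D₀.f := fun w hw ↦ by
    have h := pMulLatticeLeGamma1OfTracelessPrime_holds N D₀.f D₀.isNewformOf.1 2 Nat.prime_two
      ((dvd_pow_self 2 two_ne_zero).trans h4) (D₀.isNewformOf.1.cuspCoeff_eq_zero_of_sq_dvd Nat.prime_two h4) w hw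
    exact_mod_cast h
  -- `Λ_{E₀} ⊆ Λ_{E₁} ⊆ ½Λ_{E₀}`
  have hle : D₀.L.lattice ≤ D₁.L.lattice := by
    intro z hz
    obtain ⟨w, hw, rfl⟩ := h₀ z hz
    have h2w : ε * ((2 : ℂ) * w) ∈ periodLatticeGamma1 D₁.f := by rw [hf]; exact hεmem _ _ (h2Λ w hw)
    have e : (D₀.c : ℂ) * w = (D₁.c : ℂ) * (ε * (2 * w)) := by rw [hcc]; ring
    rw [e]
    exact D₁.smul_periodLatticeGamma1_le _ h2w
  have htwo : ∀ w ∈ D₁.L.lattice, 2 * w ∈ D₀.L.lattice := by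
    intro w hw
    obtain ⟨w₁, hw₁, rfl⟩ := h₁ w hw
    have hw₀ : ε * w₁ ∈ periodLattice D₀.f := hεmem _ _ (hf ▸ periodLatticeGamma1_le_periodLattice D₁.f hw₁)
    have e : 2 * ((D₁.c : ℂ) * w₁) = (D₀.c : ℂ) * (ε * w₁) := by
      rw [hcc]; linear_combination -(2 * (D₁.c : ℂ) * w₁) * hε2
    rw [e]
    exact D₀.smul_periodLattice_le _ hw₀
  -- the Shimura kernel is non-trivial (else `|c₀| = |c₁|`, contradicting doubling)
  have hΛne : periodLatticeGamma1 D₀.f ≠ periodLattice D₀.f := by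
    intro hΛ
    have heq := natAbs_maninConstant₀_eq_of_periodLatticeGamma1_eq_periodLattice D₁ D₀ h₁ h₀ hf hΛ
    omega
  rcases halfLattice_trichotomy D₀.L D₁.L hle htwo with hcase | hcase | hcase
  -- (i) `Λ_{E₁} = Λ_{E₀}`: the index-`4` configuration, excluded by hypothesis
  · apply hne4
    intro z
    constructor
    · intro hz
      have hz' : (D₁.c : ℂ) * z ∈ D₀.L.lattice := hcase _ (D₁.smul_periodLatticeGamma1_le z hz)
      obtain ⟨w, hw, hw'⟩ := h₀ _ hz'
      refine ⟨ε * w, hεmem _ _ hw, ?_⟩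
      have h : (D₁.c : ℂ) * z = (D₁.c : ℂ) * (2 * (ε * w)) := by rw [hw', hcc]; ring
      exact mul_left_cancel₀ hc₁ h
    · rintro ⟨w, hw, rfl⟩
      rw [hf]; exact h2Λ w hw
  -- (ii) `Λ_{E₁} ⊇ ½Λ_{E₀}`: then `Λ₁ = Λ₀`
  · apply hΛne
    refine le_antisymm (periodLatticeGamma1_le_periodLattice D₀.f) fun w hw ↦ ?_
    have h2h : 2 * (ε * ((D₁.c : ℂ) * w)) ∈ D₀.L.lattice := by
      have e : 2 * (ε * ((D₁.c : ℂ) * w)) = (D₀.c : ℂ) * w := by rw [hcc]; ring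
      rw [e]; exact D₀.smul_periodLattice_le w hw
    obtain ⟨w₁, hw₁, hw₁'⟩ := h₁ _ (hcase _ h2h)
    have hw' : w = ε * w₁ := by
      have h : (D₁.c : ℂ) * w = (D₁.c : ℂ) * (ε * w₁) := by
        linear_combination ε * hw₁' - ((D₁.c : ℂ) * w) * hε2
      exact mul_left_cancel₀ hc₁ h
    rw [hw', ← hf]; exact hεmem _ _ hw₁
  -- (iii) index 2 with half-period `z₀ = c₁w₁`: E-an-152 says the attached root is blind; the Vélu step refutes it
  · obtain ⟨z₀, hz₀', hz₀, hidx⟩ := hcase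
    have h2z₀ : 2 * z₀ ∈ D₀.L.lattice := htwo z₀ hz₀'
    obtain ⟨w₁, hw₁, hzw⟩ := h₁ z₀ hz₀'
    have hw : ε * w₁ ∈ periodLatticeGamma1 D₀.f := hf ▸ hεmem _ _ hw₁
    have hzε : (D₀.c : ℂ) * (ε * w₁) / 2 = z₀ := by
      rw [hzw, hcc]; linear_combination ((D₁.c : ℂ) * w₁) * hε2
    have hw2 : ∀ v ∈ periodLattice D₀.f, ε * w₁ ≠ 2 * v := by
      intro v hv hvw
      apply hz₀
      have e : z₀ = (D₀.c : ℂ) * v := by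
        rw [← hzε, hvw]; ring
      rw [e]; exact D₀.smul_periodLattice_le v hv
    obtain ⟨A₂, A₄, E, hA₂, hA₄, heE, hxE, hbl⟩ := h152 W₀ D₀ h₀ h4 ha₁ ha₃ hΛne (ε * w₁) hw hw2
    rw [hzε] at hxE
    exact false_of_blind_halfPeriod_neronLattice ha₁ ha₃ D₀.isNeronLattice D₁.isNeronLattice hA₂ hA₄ heE hbl
      hz₀ h2z₀ hxE hle hz₀' hidx

/-- **The mixed-locus assembly (THEOREM):** E-an-152 ∧ E-an-152b give E-an-151 on every pair with `a₁ = a₃ = 0` (S-an-65 proved above; = `transfer_of_kernel_rows kernelToLedgerEdge_holds`, primed name — typer). -/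
theorem transfer_of_kernel_rows' (h152 : ShimuraKernelBlindAtFour) (h152b : ShimuraIndexNeFourAtFour)
    {W₁ W₀ : WeierstrassCurve ℚ} [W₁.IsElliptic] [W₁.IsGloballyMinimal] [W₀.IsElliptic] [W₀.IsGloballyMinimal]
    {N : ℕ} [NeZero N] (D₁ : Gamma1ParametrizationData W₁ N) (D₀ : ModularParametrizationData W₀ N)
    (hiso : IsIsogenous W₁ W₀) (h₁ : D₁.IsOptimal)
    (h₀ : ∀ z ∈ D₀.L.lattice, ∃ w ∈ periodLattice D₀.f, z = D₀.c * w) (h4 : 2 ^ 2 ∣ N)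
    (ha₁ : W₀.a₁ = 0) (ha₃ : W₀.a₃ = 0) :
    D₀.maninConstant.natAbs = D₁.maninConstant.natAbs := by
  exact transfer_of_kernel_rows kernelToLedgerEdge_holds h152 h152b D₁ D₀ hiso h₁ h₀ h4 ha₁ ha₃

/-- **THE KERNEL-ROW ASSEMBLY OF C2 (THEOREM, no fact beyond F-need): on globally minimal models with `a₁ = a₃ = 0`,
C2 for a lattice-optimal `X₀(N)`-datum ⟸ C2¹-class ∧ E-an-152 ∧ E-an-152b.**  (With es's E-es-112 for C2¹-class:
`gammaOneOddOfClassAtFour_of_gammaOneOddAtFour`.) -/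
theorem maninOdd_of_kernel_rows (hex : exists_optimal_gamma1ParametrizationData) (h1 : GammaOneOddOfClassAtFour)
    (h152 : ShimuraKernelBlindAtFour) (h152b : ShimuraIndexNeFourAtFour)
    {W₀ : WeierstrassCurve ℚ} [W₀.IsElliptic] [W₀.IsGloballyMinimal] {N : ℕ} [NeZero N] (D₀ : ModularParametrizationData W₀ N)
    (h₀ : ∀ z ∈ D₀.L.lattice, ∃ w ∈ periodLattice D₀.f, z = D₀.c * w) (h4 : 2 ^ 2 ∣ N)
    (ha₁ : W₀.a₁ = 0) (ha₃ : W₀.a₃ = 0) : ¬ (2 : ℤ) ∣ D₀.maninConstant := by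
  obtain ⟨W₁, _, _, D₁, hiso, h₁⟩ := hex W₀ D₀ h₀
  have he := transfer_of_kernel_rows' h152 h152b D₁ D₀ hiso h₁ h₀ h4 ha₁ ha₃
  intro h2
  apply h1 W₁ W₀ D₁ D₀ hiso h₁ h₀ h4
  have : (2 : ℤ) ∣ (D₁.maninConstant.natAbs : ℤ) := by rw [← he]; exact Int.dvd_natAbs.mpr h2
  exact Int.dvd_natAbs.mp this

/-- Same with es's node E-es-112 in place of the class form. -/
theorem maninOdd_of_kernel_rows_of_gammaOneOddAtFour (hex : exists_optimal_gamma1ParametrizationData) (h112 : GammaOneOddAtFour)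
    (h152 : ShimuraKernelBlindAtFour) (h152b : ShimuraIndexNeFourAtFour)
    {W₀ : WeierstrassCurve ℚ} [W₀.IsElliptic] [W₀.IsGloballyMinimal] {N : ℕ} [NeZero N] (D₀ : ModularParametrizationData W₀ N)
    (h₀ : ∀ z ∈ D₀.L.lattice, ∃ w ∈ periodLattice D₀.f, z = D₀.c * w) (h4 : 2 ^ 2 ∣ N)
    (ha₁ : W₀.a₁ = 0) (ha₃ : W₀.a₃ = 0) : ¬ (2 : ℤ) ∣ D₀.maninConstant :=
  maninOdd_of_kernel_rows hex (gammaOneOddOfClassAtFour_of_gammaOneOddAtFour h112) h152 h152b D₀ h₀ h4 ha₁ ha₃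

end Summit.BirchSwinnertonDyer.Rank1Residual.ManinAdditive.ShimuraKernel

end
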